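/-
COR-CM (cell pub-hodgecm2, stage 2 of the Hodge ladder) — DELREC (PLANNER-D «Deligne record → printed constituents», row S1a;
seat prover-pub-hodgecm2-delrec-p3-g0-0 = delrec-p3).  THEOREMS ONLY (kernel lane): no definition, no instance, no notation, no
named fact; nothing landed is edited or restated; new declaration names under the (N3) blanket `Summits/HodgeConjecture/CorCM/DelRec/*`.
FRAMING: HC_CM is NOT proved; nothing here discharges the citation — it DERIVES the packaged record `h : exists_recordSystem` of the
END displays from the ONE printed existential `canonicalModel_exists_printed` (row L1), so that an END variant may display the latter.
-/
import Literature.AlgebraicGeometry.ShimuraVarieties.UnitaryShimuraCanonicalModelPrinted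
import Summits.HodgeConjecture.CorCM.B01.Transposition.HComp.ComplexRecordSystemOfPieces
import HarnessLib

/-!
# The packaged Deligne record follows from the printed existential: `canonicalModel_exists_printed → exists_recordSystem`

Main result (namespace `Summit.HodgeConjecture.CorCM.DelRec`):

* **`exists_recordSystem_of_printed`** — the displayed binder `h : UnitaryCanonicalModel.exists_recordSystem` of the END files
  (`Literature/AlgebraicGeometry/ShimuraVarieties/UnitaryShimuraCanonicalModel.lean` :411: [Deligne1979ShimuraVarieties] 2.2.5 +
  Cor. 2.7.21 with 2.1.2–2.1.4 and [Milne2005ShimuraVarieties] Def. 12.8 (62), read on the one datum `(Res_{L⁺/ℚ} U(H), 𝔹²)` of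
  [Liu2021] App. C, packaged as the 7-field `RecordSystem`) FOLLOWS from the printed existential
  `UnitaryCanonicalModel.canonicalModel_exists_printed` of row L1 (`UnitaryShimuraCanonicalModelPrinted.lean`): «at every datum of the
  named fact, EVERY complex record system `Sc` (the complex Shimura surface system `M_ℂ(G,X)`, [Del79] 2.1.2–2.1.4) admits an
  `L`-descent `(M, e : M ⋙ (· ⊗_{L,τ} ℂ) ≅ Sc.Mc)` by smooth projective `L`-schemes on which `Aut(ℂ/τL)` acts at the diagonal special
  points by (62)» (`IsCanonicalDescentAt Sc M e`).
  PROOF (three steps, all tree theorems): (1) the complex record system EXISTS at every datum with no named fact —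
  `HComp.nonempty_complexRecordSystem` (`CorCM/B01/Transposition/HComp/ComplexRecordSystemOfPieces.lean` :66: one complex model
  `∐_q X_q` per small level over the tree's compact ball quotients, assembled by the unique `g = 1` Hecke translates); (2) the
  printed existential hands an `L`-descent `(M, smooth, projective, e, (62))` of THAT system; (3) an `L`-descent with reciprocity of a
  complex record system IS a record system — `UnitaryCanonicalModel.RecordSystem.nonempty_of_descent`
  (`Literature/AlgebraicGeometry/ShimuraVarieties/UnitaryShimuraRecordDescent.lean` :90: the complex clauses `pts`/`map_pts`/`hol`/
  `pieces` are transported from `Sc` along `e`).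
* `nonempty_recordSystem_of_printed` — the same read at ONE datum (the binder-level form a consumer instantiates).

The converse (`exists_recordSystem → canonicalModel_exists_printed`, by the system-level Borel uniqueness of the complex model) is
row S1b (`CorCM/DelRec/PrintedOfRecordSystem.lean`); together they make the END display an EQUIVALENT re-reading of `h`.  No Hodge
class, period, theta lift or `L`-value occurs here; HC_CM is not mentioned and not implied.

References: P. Deligne, *Variétés de Shimura* (1979), 2.1.2–2.1.4, 2.2.4–2.2.5, Cor. 2.7.21 (Milne's translation, PDF pp. 23–24, 29,
52); J. S. Milne, *Introduction to Shimura varieties* (2005/2017), Lemma 5.13 p. 57, Def. 12.8 (62) p. 114, Def. 12.10 p. 115;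
Y. Liu, *Fourier–Jacobi cycles and arithmetic relative trace formula* (2021), App. C §C.1, Rem. C.2.
-/

set_option autoImplicit false

noncomputable section

open scoped Matrix ComplexOrder
open MulAction Matrix NumberField CategoryTheory
open Literature.Geometry.ComplexHyperbolic
open Literature.AlgebraicGeometry.Motives
open Literature.NumberTheory.Automorphic
open Literature.NumberTheory.Automorphic.UnitaryGroup
open Literature.NumberTheory.Automorphic.Liu2021.AppendixC (C5.OpenCompactSubgroup C5.SmallLevel)
open Literature.AlgebraicGeometry.ShimuraVarieties.UnitaryCanonicalModel

namespace Summit.HodgeConjecture.CorCM.DelRec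

/-- **One datum**: if every complex record system at the datum `(L, H, τ, T, hT; K₀)` of the named fact admits an `L`-descent with
reciprocity (62) at the diagonal special pairs (the printed clause of [Deligne1979ShimuraVarieties] 2.2.5 + Cor. 2.7.21 at this datum,
`IsCanonicalDescentAt` of row L1), then Deligne's record system `RecordSystem L H τ T hT K₀` is inhabited — the complex system exists
with no named fact (`HComp.nonempty_complexRecordSystem`) and an `L`-descent with reciprocity of it is a record system
(`RecordSystem.nonempty_of_descent`).  HC_CM is NOT proved; nothing is discharged.
[cite: Deligne1979ShimuraVarieties, 2.2.5 and Cor. 2.7.21 (PDF pp. 29, 52 of Milne's translation); 2.1.2–2.1.4 (PDF p. 24)]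
[cite: Milne2005ShimuraVarieties, Def. 12.8 (62) p. 114; Def. 12.10 p. 115] -/
theorem nonempty_recordSystem_of_printed (L : Type) [Field L] [NumberField L] [IsCMField L] (H : Matrix (Fin 3) (Fin 3) L)
    (τ : L →+* ℂ) (T : GL (Fin 3) ℂ) (hT : formCongr (starRingEnd ℂ) T (H.map τ) = BallModel.J)
    (hpos : ∀ τ' : L →+* ℂ, InfinitePlace.mk τ' ≠ InfinitePlace.mk τ → (H.map τ').PosDef)
    (hanis : ∀ v : Fin 3 → L, Literature.AlgebraicGeometry.ShimuraVarieties.hermForm (cmConjRingHom L) H v v = 0 → v = 0)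
    (K₀ : C5.OpenCompactSubgroup ↥(finAdelic (↥(maximalRealSubfield L)) L (IsCMField.complexConj L) 3 H))
    (htf : ∀ g : finAdelic (↥(maximalRealSubfield L)) L (IsCMField.complexConj L) 3 H,
      ∀ γ ∈ arithmeticLevel (↥(maximalRealSubfield L)) L (IsCMField.complexConj L) 3 H
        (K₀.1.map (MulAut.conj g).toMonoidHom), IsOfFinOrder γ → γ = 1)
    (hdesc : ∀ Sc : ComplexRecordSystem L H τ T hT K₀,
      ∃ (M : C5.SmallLevel K₀ ⥤ SchemeOver L)
        (_ : ∀ K : C5.SmallLevel K₀, AlgebraicGeometry.SmoothOfRelativeDimension 2 (M.obj K).hom)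
        (_ : ∀ K : C5.SmallLevel K₀, IsProjectiveOver (M.obj K))
        (e : (M ⋙ Literature.AlgebraicGeometry.Motives.baseChangeHom τ) ≅ Sc.Mc),
        IsCanonicalDescentAt Sc M e) :
    Nonempty (RecordSystem L H τ T hT K₀) := by
  obtain ⟨Sc⟩ := HComp.nonempty_complexRecordSystem L H τ T hT hpos hanis K₀ htf
  obtain ⟨M, hsm, hpr, e, hrec⟩ := hdesc Sc
  exact RecordSystem.nonempty_of_descent Sc M hsm hpr e hrec

/-- **The packaged Deligne record follows from the printed existential**: `canonicalModel_exists_printed → exists_recordSystem`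
([Deligne1979ShimuraVarieties] 2.2.5 + Cor. 2.7.21 at the datum `(Res_{L⁺/ℚ} U(H), 𝔹²)`, printed form of row L1 ⇒ the 7-field record
system displayed as `h` by the END files).  Datum by datum `nonempty_recordSystem_of_printed`: the complex record system exists with
no named fact (`HComp.nonempty_complexRecordSystem`, [Del79] 2.1.2–2.1.4 PROVED on the tree's ball quotients), the printed existential
descends it to `L` with (62), and `RecordSystem.nonempty_of_descent` assembles the record.  This is the term an END variant substitutes
for `h` (`h := exists_recordSystem_of_printed hDel`).  HC_CM is NOT proved; the citation is re-read, not removed.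
[cite: Deligne1979ShimuraVarieties, 2.2.5 and Cor. 2.7.21 (PDF pp. 29, 52 of Milne's translation); 2.1.2–2.1.4 (PDF p. 24)]
[cite: Milne2005ShimuraVarieties, Def. 12.8 (62) p. 114; Def. 12.10 p. 115] [cite: Liu2021, App. C §C.1 and Rem. C.2] -/
theorem exists_recordSystem_of_printed (hDel : canonicalModel_exists_printed) : exists_recordSystem :=
  fun L _ _ _ H τ T hT hpos hanis K₀ htf =>
    nonempty_recordSystem_of_printed L H τ T hT hpos hanis K₀ htf (hDel L H τ T hT hpos hanis K₀ htf)

end Summit.HodgeConjecture.CorCM.DelRec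

end
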